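import Summits.Parity.GeneralizedHardyLittlewood.Theorems.LeeYangFibresRelativeDimOneTypeDefs
import Summits.Parity.GeneralizedHardyLittlewood.Theorems.LeeYangFibresRelativeDimOneSingularTail
import Summits.Parity.GeneralizedHardyLittlewood.Theorems.LeeYangFibresRelativeDimOneTypeDataA
import Summits.Parity.GeneralizedHardyLittlewood.Theorems.LeeYangFibresRelativeDimOneTypeDataD
import Summits.Parity.GeneralizedHardyLittlewood.Theorems.LeeYangFibresRelativeDimOneSplitEulerExpansion
import Summits.Parity.GeneralizedHardyLittlewood.Theorems.LeeYangFibresRelativeDimOneSplitCosetMean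
import Literature.NumberTheory.Sieve.GallagherSingularSeries
import HarnessLib

/-!
# Route `LeeYangFibres`, crux `RelativeDimOne` (stmt-Parity-14113), line `gallagher-backwards-split` (RESHAPED,
# type-conditioned split): the Hardy–Littlewood weight toolkit and the MEAN WEIGHT AT A ROUGH PRIME for
# `stub_typeRigidity`

Helper file for the registered stub `stub_typeRigidity : TypeRigidity` (lead seat c1), vocabulary
`LeeYangFibresRelativeDimOneTypeDefs`: `wt a b p = |β_p(sys a b) − 1| + t²/p²`, `wprod q a b = ∏_{p ∣ q} wt a b p`.

* INVARIANCE (`wt_congr_mod`, `wt_eq_of_incType_eq`, `wprod_congr_mod`, `wprod_eq_of_types`): the weights see the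
  shifts only modulo the prime / only through the incidence type; MULTIPLICATIVITY (`wprod_mul_of_coprime`,
  `wprod_prod_primes`) and the CHINESE REMAINDER THEOREM for the mean (`sum_piFinset_prod_wt`,
  `sum_piFinset_wprod_of_squarefree`): `Σ_{y ∈ [0, ∏S)^t} ∏_{p ∈ S} wt_p(y) = ∏_{p ∈ S} Σ_{x ∈ [0,p)^t} wt_p(x)`.
* THE MEAN WEIGHT AT A PRIME (`rigidity_meanWt_le`, the registered hook): for `0 < |a_i| ≤ L < p`, `p ≥ 2t`,
  `Σ_{v ∈ [0,p)^t} wt(a, v, p) ≤ 7 t⁴ p^t / p²`. GENERIC `v` (no two forms `a_i n + v_i` share a root mod `p`,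
  i.e. `p ∤ a_i v_k − a_k v_i` for `i ≠ k`) have `|β_p − 1| ≤ t²/p²` (Green–Tao Lemma 1.3,
  `abs_localFactor_sub_one_le_of_generic`), so `wt ≤ 2t²/p²`; every `v` has `wt ≤ 4t/p + t²/p²`
  (`abs_localFactor_sub_one_le_of_coeff`); and the non-generic `v` are few: for fixed `i ≠ k` the congruence
  `a_i v_k ≡ a_k v_i` determines `v_k` (`a_i` is a unit mod `p`), so at most `t² p^{t−1}` of the `p^t` vectors are
  non-generic. Total `≤ (2t² + 4t³ + t⁴) p^t/p² ≤ 7 t⁴ p^t/p²`.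

References: B. Green, T. Tao, Ann. of Math. 171 (2010), Lemma 1.3, (1.6) [GreenTao2010]; P. X. Gallagher,
Mathematika 23 (1976), §2 [Gallagher1976].
-/

noncomputable section

open scoped BigOperators Classical
open Finset Literature.NumberTheory.Sieve
open Summit.Parity.GeneralizedHardyLittlewood.Cruxes.RelativeDimOne.GallagherBackwardsSplit
open Summit.Parity.GeneralizedHardyLittlewood.Cruxes.RelativeDimOne.TranslateAmplification.SingularTailProof
  (abs_localFactor_sub_one_le_of_generic abs_localFactor_sub_one_le_of_coeff)

namespace Summit.Parity.GeneralizedHardyLittlewood.Cruxes.RelativeDimOne.TypeSplit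

variable {t : ℕ}

/-! ### Positivity and invariance of the weights -/

/-- The local weight `wt a b p = |β_p − 1| + t²/p²` is non-negative. -/
theorem wt_nonneg (a b : Fin t → ℤ) (p : ℕ) : 0 ≤ wt a b p :=
  add_nonneg (abs_nonneg _) (by positivity)

/-- The multiplicative weight `wprod q a b = ∏_{p ∣ q} wt a b p` is non-negative. -/
theorem wprod_nonneg (q : ℕ) (a b : Fin t → ℤ) : 0 ≤ wprod q a b :=
  Finset.prod_nonneg fun p _ => wt_nonneg a b p

/-- The local weight at `p` only depends on the shift vector modulo `p` (so does `β_p`, `localFactor_sys_congr`). -/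
theorem wt_congr_mod (a : Fin t → ℤ) {p : ℕ} {b b' : Fin t → ℤ} (h : ∀ i, b i ≡ b' i [ZMOD p]) :
    wt a b p = wt a b' p := by
  unfold wt
  rw [CosetMeanProof.localFactor_sys_congr a h]

/-- The local weight at a prime `p` only depends on the incidence type modulo `p`
(`localFactor_sys_eq_of_incType_eq`). -/
theorem wt_eq_of_incType_eq (a : Fin t → ℤ) {p : ℕ} (hp : p.Prime) {b b' : Fin t → ℤ}
    (h : incType p a b = incType p a b') : wt a b p = wt a b' p := by
  unfold wt
  rw [localFactor_sys_eq_of_incType_eq p hp a b b' h]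

/-- Periodicity in Gallagher's form: `wt_p` is unchanged under `x ↦ x mod n` whenever `p ∣ n`. -/
theorem wt_modVec (a : Fin t → ℤ) {p n : ℕ} (hpn : p ∣ n) (x : Fin t → ℕ) :
    wt a (fun i => ((Gallagher.modVec n x i : ℕ) : ℤ)) p = wt a (fun i => (x i : ℤ)) p := by
  refine wt_congr_mod a fun i => ?_
  rw [Gallagher.modVec_apply, Int.natCast_emod]
  exact (Int.mod_modEq _ _).of_dvd (Int.natCast_dvd_natCast.2 hpn)

/-- The multiplicative weight of `q` only depends on the shift vector modulo `q` (each `p ∈ q.primeFactors`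
divides `q`). -/
theorem wprod_congr_mod (a : Fin t → ℤ) {q : ℕ} {b b' : Fin t → ℤ} (h : ∀ i, b i ≡ b' i [ZMOD q]) :
    wprod q a b = wprod q a b' :=
  Finset.prod_congr rfl fun _ hp => wt_congr_mod a fun i => TypeDataProof.modEq_of_mem_primeFactors hp (h i)

/-- The multiplicative weight of `q` only depends on the incidence types at the primes of `q`. -/
theorem wprod_eq_of_types (a : Fin t → ℤ) {q : ℕ} {b b' : Fin t → ℤ}
    (h : ∀ p ∈ q.primeFactors, incType p a b = incType p a b') : wprod q a b = wprod q a b' :=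
  Finset.prod_congr rfl fun p hp => wt_eq_of_incType_eq a (Nat.prime_of_mem_primeFactors hp) (h p hp)

/-- Multiplicativity: `wprod (m n) = wprod m · wprod n` for coprime `m, n ≥ 1` (the prime factors of `m n` are the
disjoint union of those of `m` and `n`). -/
theorem wprod_mul_of_coprime (a b : Fin t → ℤ) {m n : ℕ} (hm : 0 < m) (hn : 0 < n) (h : Nat.Coprime m n) :
    wprod (m * n) a b = wprod m a b * wprod n a b := by
  unfold wprod
  rw [Nat.primeFactors_mul hm.ne' hn.ne', Finset.prod_union h.disjoint_primeFactors]

/-- For a finite set `S` of primes, `wprod (∏_{p ∈ S} p) a b = ∏_{p ∈ S} wt a b p`. -/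
theorem wprod_prod_primes (a b : Fin t → ℤ) (S : Finset ℕ) (hS : ∀ p ∈ S, p.Prime) :
    wprod (∏ p ∈ S, p) a b = ∏ p ∈ S, wt a b p := by
  unfold wprod
  rw [Nat.primeFactors_prod hS]

/-! ### The Chinese remainder theorem for the mean weight -/

/-- CRT FOR THE MEAN WEIGHT: for a finite set `S` of primes,
`Σ_{y ∈ [0, ∏S)^t} ∏_{p ∈ S} wt_p(y) = ∏_{p ∈ S} Σ_{x ∈ [0,p)^t} wt_p(x)` (induction on `S`: `[0, p P')^t ≅ [0,p)^t × [0,P')^t`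
by `TypeDataProof.sum_piFinset_mul_of_coprime`, with the periodicity `wt_modVec`). -/
theorem sum_piFinset_prod_wt (a : Fin t → ℤ) (S : Finset ℕ) (hS : ∀ p ∈ S, p.Prime) :
    ∑ y ∈ Fintype.piFinset (fun _ : Fin t => Finset.range (∏ p ∈ S, p)),
        ∏ p ∈ S, wt a (fun i => (y i : ℤ)) p =
      ∏ p ∈ S, ∑ x ∈ Fintype.piFinset (fun _ : Fin t => Finset.range p), wt a (fun i => (x i : ℤ)) p := by
  induction S using Finset.induction_on with
  | empty => simp
  | insert p S hpS ih =>
    have hp : p.Prime := hS p (mem_insert_self _ _)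
    have hS' : ∀ q ∈ S, q.Prime := fun q hq => hS q (mem_insert_of_mem hq)
    have hP'pos : 0 < ∏ q ∈ S, q := Finset.prod_pos fun q hq => (hS' q hq).pos
    have hcop : Nat.Coprime p (∏ q ∈ S, q) :=
      Nat.Coprime.prod_right fun q hq => (Nat.coprime_primes hp (hS' q hq)).2 fun h => hpS (h ▸ hq)
    rw [Finset.prod_insert hpS, Finset.prod_insert hpS, ← ih hS']
    simp_rw [Finset.prod_insert hpS]
    rw [← TypeDataProof.sum_piFinset_mul_of_coprime hp.pos hP'pos hcop
      (fun x : Fin t → ℕ => wt a (fun i => (x i : ℤ)) p)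
      (fun y : Fin t → ℕ => ∏ q ∈ S, wt a (fun i => (y i : ℤ)) q)]
    refine Finset.sum_congr rfl fun r _ => ?_
    rw [wt_modVec a (dvd_refl p) r]
    congr 1
    exact (Finset.prod_congr rfl fun q hq =>
      wt_modVec a (Finset.dvd_prod_of_mem (fun i : ℕ => i) hq) r).symm

/-- For squarefree `q`: `Σ_{y ∈ [0,q)^t} wprod q a y = ∏_{p ∣ q} Σ_{x ∈ [0,p)^t} wt_p(x)` (`q = ∏_{p ∣ q} p`). -/
theorem sum_piFinset_wprod_of_squarefree (a : Fin t → ℤ) {q : ℕ} (hq : Squarefree q) :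
    ∑ y ∈ Fintype.piFinset (fun _ : Fin t => Finset.range q), wprod q a (fun i => (y i : ℤ)) =
      ∏ p ∈ q.primeFactors, ∑ x ∈ Fintype.piFinset (fun _ : Fin t => Finset.range p),
        wt a (fun i => (x i : ℤ)) p := by
  rw [← sum_piFinset_prod_wt a q.primeFactors (fun p hp => Nat.prime_of_mem_primeFactors hp),
    Nat.prod_primeFactors_of_squarefree hq]
  rfl

/-! ### The mean weight at a prime -/

namespace MeanWeightProof

/-- COUNTING THE NON-GENERIC VECTORS, one pair at a time: for `i ≠ k` and `a_i` a unit mod `p`, the vectors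
`v ∈ [0,p)^t` with `a_i v_k ≡ a_k v_i (mod p)` number at most `p^{t−1}` (`(v, c) ↦ v[k ↦ c]` is injective on
`{solutions} × [0,p)` into `[0,p)^t`: `v_k` is recovered from `v_i` by cancelling the unit `a_i`). -/
theorem card_filter_cong_mul_le {p : ℕ} [Fact p.Prime] (a : Fin t → ℤ) {i k : Fin t} (hik : i ≠ k)
    (hai : ((a i : ℤ) : ZMod p) ≠ 0) :
    #((Fintype.piFinset fun _ : Fin t => range p).filter
        (fun v => ((a i * (v k : ℤ) - a k * (v i : ℤ) : ℤ) : ZMod p) = 0)) * p ≤ p ^ t := by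
  set S := (Fintype.piFinset fun _ : Fin t => range p).filter
    (fun v => ((a i * (v k : ℤ) - a k * (v i : ℤ) : ℤ) : ZMod p) = 0) with hS
  have hcard : #(S ×ˢ range p) = #S * p := by rw [Finset.card_product, Finset.card_range]
  rw [← hcard]
  calc #(S ×ˢ range p) ≤ #(Fintype.piFinset fun _ : Fin t => range p) := by
        refine Finset.card_le_card_of_injOn (fun vc => Function.update vc.1 k vc.2) ?_ ?_
        · rintro ⟨v, c⟩ hvc
          rw [Finset.mem_coe, Finset.mem_product] at hvc
          obtain ⟨hvS, hc⟩ := hvc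
          rw [hS, Finset.mem_filter, Fintype.mem_piFinset] at hvS
          rw [Finset.mem_coe, Fintype.mem_piFinset]
          intro j
          show Function.update v k c j ∈ range p
          rcases eq_or_ne j k with rfl | hjk
          · rw [Function.update_self]
            exact hc
          · rw [Function.update_of_ne hjk]
            exact hvS.1 j
        · rintro ⟨v, c⟩ hvc ⟨v', c'⟩ hvc' heq
          rw [Finset.coe_product, Set.mem_prod, Finset.mem_coe, Finset.mem_coe] at hvc hvc'
          obtain ⟨hvS, -⟩ := hvc
          obtain ⟨hvS', -⟩ := hvc'
          rw [hS, Finset.mem_filter, Fintype.mem_piFinset] at hvS hvS'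
          dsimp only at heq
          have hcc : c = c' := by
            have := congr_fun heq k
            rwa [Function.update_self, Function.update_self] at this
          have hoff : ∀ j, j ≠ k → v j = v' j := fun j hjk => by
            have := congr_fun heq j
            rwa [Function.update_of_ne hjk, Function.update_of_ne hjk] at this
          have hii : v i = v' i := hoff i hik
          have h1 := hvS.2
          have h2 := hvS'.2
          push_cast at h1 h2
          rw [← hii] at h2
          rw [sub_eq_zero] at h1 h2
          have h3 : ((a i : ℤ) : ZMod p) * ((v k : ℕ) : ZMod p) = ((a i : ℤ) : ZMod p) * ((v' k : ℕ) : ZMod p) := by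
            rw [h1, h2]
          have h4 := mul_left_cancel₀ hai h3
          rw [ZMod.natCast_eq_natCast_iff', Nat.mod_eq_of_lt (mem_range.1 (hvS.1 k)),
            Nat.mod_eq_of_lt (mem_range.1 (hvS'.1 k))] at h4
          refine Prod.ext (funext fun j => ?_) hcc
          rcases eq_or_ne j k with rfl | hjk
          · exact h4
          · exact hoff j hjk
    _ = p ^ t := by rw [Fintype.card_piFinset_const, Finset.card_range]

/-- THE MEAN WEIGHT AT A PRIME: for `0 < |a_i| ≤ L < p` and `p ≥ 2t`, `Σ_{v ∈ [0,p)^t} wt(a, v, p) ≤ 7 t⁴ p^t/p²`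
(generic `v`: `wt ≤ 2t²/p²`, at most `p^t` of them; non-generic `v`: `wt ≤ 4t/p + t²/p²`, at most `t² p^{t−1}`
of them). -/
theorem meanWt_le (L : ℕ) (a : Fin t → ℤ) (ha : ∀ i, a i ≠ 0 ∧ |a i| ≤ L) {p : ℕ} (hp : p.Prime)
    (hLp : L < p) (h2t : 2 * t ≤ p) :
    ∑ v ∈ Fintype.piFinset (fun _ : Fin t => Finset.range p), wt a (fun i => (v i : ℤ)) p ≤
      7 * (t : ℝ) ^ 4 * (p : ℝ) ^ t / (p : ℝ) ^ 2 := by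
  haveI := Fact.mk hp
  set B := Fintype.piFinset (fun _ : Fin t => Finset.range p) with hB
  have hBcard : #B = p ^ t := by rw [hB, Fintype.card_piFinset_const, Finset.card_range]
  have hp0 : (0 : ℝ) < p := by exact_mod_cast hp.pos
  have hp1 : (1 : ℝ) ≤ p := by exact_mod_cast hp.one_lt.le
  -- the coefficients are units mod `p`
  have hA : ∀ i, ((a i : ℤ) : ZMod p) ≠ 0 := fun i => by
    refine intCast_zmod_ne_zero_of_natAbs_lt (ha i).1 ?_
    have h := (ha i).2
    rw [Int.abs_eq_natAbs] at h
    omega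
  -- pointwise bounds: generic vectors and all vectors
  have hwt_gen : ∀ v : Fin t → ℕ,
      (∀ i k, i ≠ k → ((a i * (v k : ℤ) - a k * (v i : ℤ) : ℤ) : ZMod p) ≠ 0) →
        wt a (fun i => (v i : ℤ)) p ≤ 2 * ((t : ℝ) ^ 2 / (p : ℝ) ^ 2) := by
    intro v hv
    have := abs_localFactor_sub_one_le_of_generic (sys a (fun i => (v i : ℤ))) hp (fun i => hA i)
      (fun i k hik => hv i k hik) h2t
    unfold wt
    linarith
  have hwt_all : ∀ v : Fin t → ℕ,
      wt a (fun i => (v i : ℤ)) p ≤ 4 * (t : ℝ) / p + (t : ℝ) ^ 2 / (p : ℝ) ^ 2 := by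
    intro v
    have := abs_localFactor_sub_one_le_of_coeff (sys a (fun i => (v i : ℤ))) hp (fun i => hA i) h2t
    unfold wt
    linarith
  -- the non-generic vectors are few
  have hcount : (#(B.filter fun v =>
      ¬ ∀ i k, i ≠ k → ((a i * (v k : ℤ) - a k * (v i : ℤ) : ℤ) : ZMod p) ≠ 0) : ℝ) ≤
        (t : ℝ) ^ 2 * ((p : ℝ) ^ t / p) := by
    have hsub : (B.filter fun v => ¬ ∀ i k, i ≠ k → ((a i * (v k : ℤ) - a k * (v i : ℤ) : ℤ) : ZMod p) ≠ 0) ⊆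
        (univ : Finset (Fin t)).offDiag.biUnion fun ik =>
          B.filter fun v => ((a ik.1 * (v ik.2 : ℤ) - a ik.2 * (v ik.1 : ℤ) : ℤ) : ZMod p) = 0 := by
      intro v hv
      rw [Finset.mem_filter] at hv
      obtain ⟨hvB, hvG⟩ := hv
      push Not at hvG
      obtain ⟨i, k, hik, hz⟩ := hvG
      exact Finset.mem_biUnion.2 ⟨(i, k), Finset.mem_offDiag.2 ⟨mem_univ _, mem_univ _, hik⟩,
        Finset.mem_filter.2 ⟨hvB, hz⟩⟩
    have heach : ∀ ik ∈ (univ : Finset (Fin t)).offDiag,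
        (#(B.filter fun v => ((a ik.1 * (v ik.2 : ℤ) - a ik.2 * (v ik.1 : ℤ) : ℤ) : ZMod p) = 0) : ℝ) ≤
          (p : ℝ) ^ t / p := by
      intro ik hik
      rw [Finset.mem_offDiag] at hik
      rw [le_div_iff₀ hp0]
      exact_mod_cast card_filter_cong_mul_le a hik.2.2 (hA ik.1)
    calc (#(B.filter fun v =>
          ¬ ∀ i k, i ≠ k → ((a i * (v k : ℤ) - a k * (v i : ℤ) : ℤ) : ZMod p) ≠ 0) : ℝ)
        ≤ #((univ : Finset (Fin t)).offDiag.biUnion fun ik =>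
            B.filter fun v => ((a ik.1 * (v ik.2 : ℤ) - a ik.2 * (v ik.1 : ℤ) : ℤ) : ZMod p) = 0) := by
          exact_mod_cast Finset.card_le_card hsub
      _ ≤ ∑ ik ∈ (univ : Finset (Fin t)).offDiag,
            (#(B.filter fun v => ((a ik.1 * (v ik.2 : ℤ) - a ik.2 * (v ik.1 : ℤ) : ℤ) : ZMod p) = 0) : ℝ) := by
          exact_mod_cast Finset.card_biUnion_le
      _ ≤ ∑ ik ∈ (univ : Finset (Fin t)).offDiag, (p : ℝ) ^ t / p := Finset.sum_le_sum heach
      _ = #((univ : Finset (Fin t)).offDiag) * ((p : ℝ) ^ t / p) := by rw [Finset.sum_const, nsmul_eq_mul]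
      _ ≤ (t : ℝ) ^ 2 * ((p : ℝ) ^ t / p) := by
          refine mul_le_mul_of_nonneg_right ?_ (by positivity)
          have : #((univ : Finset (Fin t)).offDiag) ≤ t ^ 2 := by
            rw [Finset.offDiag_card, Finset.card_univ, Fintype.card_fin, sq]
            exact Nat.sub_le _ _
          exact_mod_cast this
  -- numerics in `t`
  have ht2 : (t : ℝ) ^ 2 ≤ (t : ℝ) ^ 4 := by
    have : t ^ 2 ≤ t ^ 4 := by
      rcases Nat.eq_zero_or_pos t with h | h
      · simp [h]
      · exact Nat.pow_le_pow_right h (by norm_num)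
    exact_mod_cast this
  have ht3 : (t : ℝ) ^ 3 ≤ (t : ℝ) ^ 4 := by
    have : t ^ 3 ≤ t ^ 4 := by
      rcases Nat.eq_zero_or_pos t with h | h
      · simp [h]
      · exact Nat.pow_le_pow_right h (by norm_num)
    exact_mod_cast this
  have hX : (0 : ℝ) ≤ (p : ℝ) ^ t / (p : ℝ) ^ 2 := by positivity
  have hX3 : (p : ℝ) ^ t / (p : ℝ) ^ 3 ≤ (p : ℝ) ^ t / (p : ℝ) ^ 2 :=
    div_le_div_of_nonneg_left (by positivity) (by positivity) (pow_le_pow_right₀ hp1 (by norm_num))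
  have h1 := mul_le_mul_of_nonneg_right ht2 hX
  have h2 := mul_le_mul_of_nonneg_right ht3 hX
  have h3 := mul_le_mul_of_nonneg_left hX3 (by positivity : (0 : ℝ) ≤ (t : ℝ) ^ 4)
  -- assembly
  have hsplit := (Finset.sum_filter_add_sum_filter_not B
    (fun v => ∀ i k, i ≠ k → ((a i * (v k : ℤ) - a k * (v i : ℤ) : ℤ) : ZMod p) ≠ 0)
    (fun v => wt a (fun i => (v i : ℤ)) p)).symm
  rw [hsplit]
  calc ∑ v ∈ B.filter (fun v => ∀ i k, i ≠ k → ((a i * (v k : ℤ) - a k * (v i : ℤ) : ℤ) : ZMod p) ≠ 0),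
          wt a (fun i => (v i : ℤ)) p +
        ∑ v ∈ B.filter (fun v => ¬ ∀ i k, i ≠ k → ((a i * (v k : ℤ) - a k * (v i : ℤ) : ℤ) : ZMod p) ≠ 0),
          wt a (fun i => (v i : ℤ)) p
      ≤ ∑ v ∈ B.filter (fun v => ∀ i k, i ≠ k → ((a i * (v k : ℤ) - a k * (v i : ℤ) : ℤ) : ZMod p) ≠ 0),
          2 * ((t : ℝ) ^ 2 / (p : ℝ) ^ 2) +
        ∑ v ∈ B.filter (fun v => ¬ ∀ i k, i ≠ k → ((a i * (v k : ℤ) - a k * (v i : ℤ) : ℤ) : ZMod p) ≠ 0),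
          (4 * (t : ℝ) / p + (t : ℝ) ^ 2 / (p : ℝ) ^ 2) :=
        add_le_add (Finset.sum_le_sum fun v hv => hwt_gen v (Finset.mem_filter.1 hv).2)
          (Finset.sum_le_sum fun v _ => hwt_all v)
    _ = #(B.filter (fun v => ∀ i k, i ≠ k → ((a i * (v k : ℤ) - a k * (v i : ℤ) : ℤ) : ZMod p) ≠ 0)) *
          (2 * ((t : ℝ) ^ 2 / (p : ℝ) ^ 2)) +
        #(B.filter (fun v => ¬ ∀ i k, i ≠ k → ((a i * (v k : ℤ) - a k * (v i : ℤ) : ℤ) : ZMod p) ≠ 0)) *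
          (4 * (t : ℝ) / p + (t : ℝ) ^ 2 / (p : ℝ) ^ 2) := by
        rw [Finset.sum_const, Finset.sum_const, nsmul_eq_mul, nsmul_eq_mul]
    _ ≤ (p : ℝ) ^ t * (2 * ((t : ℝ) ^ 2 / (p : ℝ) ^ 2)) +
        (t : ℝ) ^ 2 * ((p : ℝ) ^ t / p) * (4 * (t : ℝ) / p + (t : ℝ) ^ 2 / (p : ℝ) ^ 2) := by
        refine add_le_add (mul_le_mul_of_nonneg_right ?_ (by positivity))
          (mul_le_mul_of_nonneg_right hcount (by positivity))
        exact_mod_cast (Finset.card_filter_le _ _).trans hBcard.le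
    _ = 2 * ((t : ℝ) ^ 2 * ((p : ℝ) ^ t / (p : ℝ) ^ 2)) + 4 * ((t : ℝ) ^ 3 * ((p : ℝ) ^ t / (p : ℝ) ^ 2)) +
        (t : ℝ) ^ 4 * ((p : ℝ) ^ t / (p : ℝ) ^ 3) := by ring
    _ ≤ 2 * ((t : ℝ) ^ 2 * ((p : ℝ) ^ t / (p : ℝ) ^ 2)) + 4 * ((t : ℝ) ^ 3 * ((p : ℝ) ^ t / (p : ℝ) ^ 2)) +
        (t : ℝ) ^ 4 * ((p : ℝ) ^ t / (p : ℝ) ^ 2) := by linarith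
    _ ≤ 7 * (t : ℝ) ^ 4 * (p : ℝ) ^ t / (p : ℝ) ^ 2 := by
        rw [show 7 * (t : ℝ) ^ 4 * (p : ℝ) ^ t / (p : ℝ) ^ 2 = 7 * ((t : ℝ) ^ 4 * ((p : ℝ) ^ t / (p : ℝ) ^ 2))
          by ring]
        linarith

end MeanWeightProof

/-- Registered hook `rigidity_meanWt_le` (aux for `stub_typeRigidity`): THE MEAN HARDY–LITTLEWOOD WEIGHT AT A PRIME is
`O(t⁴/p²)` — for `0 < |a_i| ≤ L < p`, `p ≥ 2t`: `Σ_{v ∈ [0,p)^t} (|β_p(a, v) − 1| + t²/p²) ≤ 7 t⁴ p^t / p²`. -/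
theorem rigidity_meanWt_le : ∀ {t : ℕ} (L : ℕ) (a : Fin t → ℤ), (∀ i, a i ≠ 0 ∧ |a i| ≤ L) → ∀ p : ℕ, p.Prime → L < p → 2 * t ≤ p → ∑ v ∈ Fintype.piFinset (fun _ : Fin t => Finset.range p), wt a (fun i => (v i : ℤ)) p ≤ 7 * (t : ℝ) ^ 4 * (p : ℝ) ^ t / (p : ℝ) ^ 2 :=
  fun L a ha _ hp hLp h2t => MeanWeightProof.meanWt_le L a ha hp hLp h2t

/-- THE MEAN WEIGHT OF A ROUGH SQUAREFREE MODULUS: if every prime factor `p` of the squarefree `q` has `p > L` and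
`p ≥ 2t`, then `Σ_{y ∈ [0,q)^t} wprod q a y ≤ ∏_{p ∣ q} (7 t⁴ p^t / p²)` (CRT + `rigidity_meanWt_le`). -/
theorem sum_piFinset_wprod_le (L : ℕ) (a : Fin t → ℤ) (ha : ∀ i, a i ≠ 0 ∧ |a i| ≤ L) {q : ℕ}
    (hq : Squarefree q) (hL : ∀ p ∈ q.primeFactors, L < p) (h2 : ∀ p ∈ q.primeFactors, 2 * t ≤ p) :
    ∑ y ∈ Fintype.piFinset (fun _ : Fin t => Finset.range q), wprod q a (fun i => (y i : ℤ)) ≤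
      ∏ p ∈ q.primeFactors, (7 * (t : ℝ) ^ 4 * (p : ℝ) ^ t / (p : ℝ) ^ 2) := by
  rw [sum_piFinset_wprod_of_squarefree a hq]
  exact Finset.prod_le_prod (fun p _ => Finset.sum_nonneg fun x _ => wt_nonneg _ _ _)
    fun p hp => rigidity_meanWt_le L a ha p (Nat.prime_of_mem_primeFactors hp) (hL p hp) (h2 p hp)

/-- The same bound for the MEAN: `(Σ_{y ∈ [0,q)^t} wprod q a y) / q^t ≤ ∏_{p ∣ q} (7 t⁴ / p²)`. -/
theorem sum_piFinset_wprod_div_le (L : ℕ) (a : Fin t → ℤ) (ha : ∀ i, a i ≠ 0 ∧ |a i| ≤ L) {q : ℕ}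
    (hq : Squarefree q) (hL : ∀ p ∈ q.primeFactors, L < p) (h2 : ∀ p ∈ q.primeFactors, 2 * t ≤ p) :
    (∑ y ∈ Fintype.piFinset (fun _ : Fin t => Finset.range q), wprod q a (fun i => (y i : ℤ))) / (q : ℝ) ^ t ≤
      ∏ p ∈ q.primeFactors, (7 * (t : ℝ) ^ 4 / (p : ℝ) ^ 2) := by
  have hq0 : (0 : ℝ) < (q : ℝ) ^ t := by
    have : 0 < q := Nat.pos_of_ne_zero hq.ne_zero
    positivity
  rw [div_le_iff₀ hq0]
  refine (sum_piFinset_wprod_le L a ha hq hL h2).trans (le_of_eq ?_)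
  have hqprod : ((q : ℕ) : ℝ) ^ t = ∏ p ∈ q.primeFactors, (p : ℝ) ^ t := by
    rw [Finset.prod_pow]
    congr 1
    rw [← Nat.cast_prod, Nat.prod_primeFactors_of_squarefree hq]
  rw [hqprod, ← Finset.prod_mul_distrib]
  refine Finset.prod_congr rfl fun p hp => ?_
  have hp0 : (0 : ℝ) < p := by exact_mod_cast (Nat.prime_of_mem_primeFactors hp).pos
  field_simp

end Summit.Parity.GeneralizedHardyLittlewood.Cruxes.RelativeDimOne.TypeSplit

end
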